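import Summits.KontsevichZagierPeriods.KontsevichZagierPeriods.Theses.TerasomaMultiplication
import Summits.KontsevichZagierPeriods.KontsevichZagierPeriods.Theorems.CompleteModGammaSector.Negative.LoadBearing
import Literature.NumberTheory.Transcendental.KZRulesAssociator
import Literature.NumberTheory.Transcendental.KZRelationsLE
import Literature.NumberTheory.Transcendental.KZSubcalculusInvariants
import Literature.NumberTheory.Transcendental.KZLogCalculusProofs

/-!
# `CompleteModGammaSector` (stmt-KontsevichZagierPeriods-14233), line `Sketch` (card
# wronskian-transport): stub `stub_torsionFreeModGamma`

Seam 1 of the line: the quotient of the formal period ring `P = KZ.FormalPeriodRing =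
FormalRep ⧸ relations` by the Γ-ideal `JΓ := Ideal.span (toFormalPeriod '' gammaHodgePairs)` is
torsion-free. In fact EVERY ideal `I` of `P` is `ℤ`-saturated, because `P` contains `1/N` for every
`N ≥ 1`: the class `u_N := ⟦[pt, 1/N]⟧` of the scaled unit representation satisfies `N • u_N = 1`
(iterated integrand additivity, `KZ.IntegralRep.of_constMul_nat_sub_nsmul_mem_relations`, plus the
congruence `[pt, N · (1/N)] ∼ [pt, 1]`), whence `x = u_N * (N • x) ∈ I` as soon as `N • x ∈ I`;
a negative integer `k` is reduced to `k.natAbs` through `I.neg_mem`.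
-/

noncomputable section

-- `Summit.KontsevichZagierPeriods.KontsevichZagierPeriods.…` is the tree's mandated layout (single-conjunct summit).
set_option linter.dupNamespace false

namespace Summit.KontsevichZagierPeriods.KontsevichZagierPeriods.CompleteModGammaSectorLine

open MeasureTheory Set
open Literature.NumberTheory.Transcendental
open Literature.NumberTheory.Transcendental.KZ
open Summit.KontsevichZagierPeriods.CompleteModGammaSectorNegative (gammaHodgePairs sector)

/-- **`P` contains `1/N`**: for `N ≥ 1` the class `⟦[pt, 1/N]⟧` of the unit representation scaled
by the rational constant `1/N` satisfies `N • ⟦[pt, 1/N]⟧ = 1` in the formal period ring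
(`[pt, 1] ∼ [pt, N · (1/N)] ∼ N • [pt, 1/N]`: congruence of integrands on the domain, then iterated
integrand additivity). [cite: KontsevichZagier2001, §1.2 rule (1)] -/
theorem nsmul_toFormalPeriod_unit_constMul_inv {N : ℕ} (hN : 0 < N) :
    N • toFormalPeriod (of (IntegralRep.unit.constMul ((N : ℝ)⁻¹) (isAlgebraic_nat N).inv)) =
      (1 : FormalPeriodRing) := by
  -- adapted from `of_sub_nsmul_of_constMul_inv_mem_relations` (Cruxes/ReducedPeriodRing/Disproof)
  rw [← toFormalPeriod_of_unit, ← map_nsmul, eq_comm, toFormalPeriod_eq_iff]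
  have hN' : (N : ℝ) ≠ 0 := by exact_mod_cast hN.ne'
  have h1 : of IntegralRep.unit -
      of ((IntegralRep.unit.constMul ((N : ℝ)⁻¹) (isAlgebraic_nat N).inv).constMul (N : ℝ)
        (isAlgebraic_nat N)) ∈ relations :=
    of_sub_of_mem_relations_of_eqOn rfl (fun x _ => by simp [hN'])
  have h2 := (IntegralRep.unit.constMul ((N : ℝ)⁻¹)
    (isAlgebraic_nat N).inv).of_constMul_nat_sub_nsmul_mem_relations N
  simpa using relations.add_mem h1 h2

/-- **Every ideal of the formal period ring is saturated with respect to positive integers**: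
if `N • x ∈ I` with `N ≥ 1` then `x = ⟦[pt, 1/N]⟧ * (N • x) ∈ I`. [folklore] -/
theorem mem_ideal_of_nsmul_mem (I : Ideal FormalPeriodRing) {N : ℕ} (hN : 0 < N)
    {x : FormalPeriodRing} (h : N • x ∈ I) : x ∈ I := by
  have hx : toFormalPeriod (of (IntegralRep.unit.constMul ((N : ℝ)⁻¹) (isAlgebraic_nat N).inv)) *
      (N • x) = x := by
    rw [mul_smul_comm, ← smul_mul_assoc, nsmul_toFormalPeriod_unit_constMul_inv hN, one_mul]
  rw [← hx]
  exact I.mul_mem_left _ h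

/-- **Every ideal of the formal period ring is `ℤ`-saturated**: if `k • x ∈ I` with `k ≠ 0` then
`x ∈ I` (reduce to `k.natAbs` through `I.neg_mem`). [folklore] -/
theorem mem_ideal_of_zsmul_mem (I : Ideal FormalPeriodRing) {k : ℤ} (hk : k ≠ 0)
    {x : FormalPeriodRing} (h : k • x ∈ I) : x ∈ I := by
  -- adapted from `mem_relations_of_zsmul_mem_relations` (Theorems/MultiplicationAccessible/Negative/Core)
  have hk0 : 0 < k.natAbs := Int.natAbs_pos.mpr hk
  rcases Int.natAbs_eq k with hk' | hk'
  · rw [hk', natCast_zsmul] at h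
    exact mem_ideal_of_nsmul_mem I hk0 h
  · rw [hk', neg_smul, natCast_zsmul] at h
    exact mem_ideal_of_nsmul_mem I hk0 ((Submodule.neg_mem_iff I).mp h)

/-- **Seam 1 (card `TorsionFreeModGamma`): the quotient of the formal period ring by the Γ-ideal
`JΓ = Ideal.span (toFormalPeriod '' gammaHodgePairs)` is torsion-free** — division by a non-zero
integer is a derived rule modulo `JΓ` (`P ∋ ⟦[pt, 1/k]⟧` with `k • ⟦[pt, 1/k]⟧ = 1`, and `JΓ` is an
ideal). [cite: KontsevichZagier2001, §1.2 rule (1)] -/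
theorem stub_torsionFreeModGamma :
    ∀ (k : ℤ) (x : FormalPeriodRing), k ≠ 0 → k • x ∈ Ideal.span (toFormalPeriod '' gammaHodgePairs) →
      x ∈ Ideal.span (toFormalPeriod '' gammaHodgePairs) :=
  fun _ _ hk h => mem_ideal_of_zsmul_mem _ hk h

end Summit.KontsevichZagierPeriods.KontsevichZagierPeriods.CompleteModGammaSectorLine

end
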